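import Literature.MathematicalPhysics.QuantumLattice.LatticeWilsonFlow
import Literature.MathematicalPhysics.QuantumLattice.FlowScale
import Literature.MathematicalPhysics.QuantumLattice.YangMillsClassicalProofs
import Mathlib.Analysis.Calculus.MeanValue
import Mathlib.Topology.Algebra.Order.Floor
import HarnessLib

/-!
# Bounded Wilson flow lines on `ℤ^d` and the periodic lift of the torus Wilson flow

Topic `Literature/MathematicalPhysics/QuantumLattice` (definition request `defn-boundedWilsonFlowLift`,
hygiene for `LatticeWilsonFlow.lean` / `FlowScale.lean`, wanted by the Yang–Mills route
`FlowLineStateSpace`).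

**The problem this file settles.** The tree's `IsWilsonFlowLine H V Φ` (Lüscher's flow equation
(1.4), entrywise `HasDerivAt` at every real time) has a unique solution on a FINITE lattice, but on
the infinite lattice `ℤ^d` its solutions are not unique: (1.4) couples a link only to the finitely
many links of the plaquettes through it, so — exactly as for the lattice heat equation
`u̇ₙ = uₙ₊₁ − 2uₙ + uₙ₋₁`, where one prescribes `u₀(t)` arbitrarily and solves outward — non-zero
global solutions with zero initial data can be produced by solving the link equations outward; they
are unbounded in space. Hence `matrixWilsonFlow (range ρ) t (ρ ∘ torusLift S U)`, a flow line picked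
by `Classical.choice`, was not provably the periodic extension of the torus flow, and neither
`flowedEnergy ρ t x (torusLift S U)` nor the intended instance `E t Ũ = flowedEnergy ρ t 0 Ũ` of
`flowScale` / `FlowSchemeData` was provably Lüscher's torus quantity. The cure is the standard one
for lattice dynamics: restrict to flow lines that are **bounded uniformly over links** (locally
uniformly in time). In that class (1.4) on `ℤ^d` is well posed, and for periodic data its solution
is the periodic extension of the torus solution — which is the object Lüscher studies ([Luscher2010]
works on a finite lattice with periodic boundary conditions; p. 2: "The existence, uniqueness and
smoothness of the Wilson flow at all positive and negative times `t` is rigorously guaranteed on a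
finite lattice").

## Contents (everything stated is proved; no named facts)

* `pi_ode_unique_of_bounded` (+ `_neg`) — uniqueness of componentwise solutions of an infinite
  system `∂ₜΦ(i) = F(Φ)(i)` that stay in a ball on which `F` is Lipschitz for the sup norm over
  components: Picard-iteration bound `‖Φ_t(i) − Ψ_t(i)‖ ≤ 2M(Kt)ⁿ/n!` by the fencing theorem, then
  `n → ∞` (no measurability of `t ↦ supᵢ` needed). [folklore; the bounded case of the classical
  lattice-dynamics argument, cf. Lanford–Lebowitz–Lieb 1977]
* `norm_plaquetteSum_le`, `norm_plaquetteSum_sub_le`, `norm_wilsonFlowField_le`,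
  `norm_wilsonFlowField_sub_le` — the vector field of (1.4) is bounded by `2dM⁵` and `10dM⁴`-Lipschitz
  (sup over links, Frobenius norm per link) on the ball `‖V(e)‖ ≤ M ∀e` (finite-range quintic
  polynomial composed with the norm-one projector `π_𝔤`).
* `IsBoundedWilsonFlowLine H V Φ` — flow line + `∀ T, ∃ C, ∀ |t| ≤ T, ∀ e i j, ‖Φ_t(e)ᵢⱼ‖ ≤ C`;
  `IsBoundedWilsonFlowLine.unique` (any site type); `boundedMatrixWilsonFlow H t V` (the bounded
  flow, junk value `V`); on a finite lattice every flow line is bounded (`IsWilsonFlowLine.isBounded`),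
  flow lines are unique (`IsWilsonFlowLine.unique_of_finite`, `IsWilsonFlowLine.eq_matrixWilsonFlow`)
  and `boundedMatrixWilsonFlow = matrixWilsonFlow` (`boundedMatrixWilsonFlow_eq_matrixWilsonFlow`).
* `IsShiftCompatible`, `plaquetteSum_comp`, `wilsonFlowField_comp`, `IsWilsonFlowLine.comp`,
  `boundedMatrixWilsonFlow_translate` — functoriality in the site type (periodic lifts, and
  lattice-translation covariance of the bounded flow).
* `IsBoundedWilsonFlowLine.periodic`, `exists_isBoundedWilsonFlowLine_comp_torusEdge_iff`,
  `boundedMatrixWilsonFlow_comp_torusEdge` — a bounded flow line from periodic data is periodic and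
  descends to the torus; a bounded flow line from `V ∘ torusEdge S` exists iff a torus flow line
  from `V` does; and **`boundedMatrixWilsonFlow H t (V ∘ torusEdge S) = matrixWilsonFlow H t V ∘
  torusEdge S` unconditionally**.
* Gauge-group level (`ρ : G →* M_N(ℂ)`): `boundedWilsonFlowMatrix ρ t U`; the static densities
  `plaquetteMatrix`, `energyDensity` with `flowedEnergy ρ t x U = energyDensity (wilsonFlowMatrix ρ t U) x`
  (`rfl`); `boundedFlowedEnergy ρ t x U`; **`boundedWilsonFlowLift ρ S t U`** — the periodic lift of
  the torus Wilson flow, `= boundedWilsonFlowMatrix ρ t (torusLift S U)`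
  (`boundedWilsonFlowMatrix_torusLift`); the **lift lemma**
  `boundedFlowedEnergy ρ t x (torusLift S U) = flowedEnergy ρ t (x mod S) U`
  (`boundedFlowedEnergy_torusLift`); for unitary `ρ` the torus density in terms of any `G`-valued
  torus flow line `B` as quantified by the route items (`flowedEnergy_eq_of_isWilsonFlowLine`).
* `flowScaleTorus d ρ β S := flowScaleOf (τ ↦ ∫ flowedEnergy ρ τ 0 U dμ_{S,β})` — Lüscher's `t₀`
  of the torus — with `flowScale ρ (t, Ũ ↦ boundedFlowedEnergy ρ t 0 Ũ) β S = flowScaleTorus d ρ β S`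
  (`flowScale_boundedFlowedEnergy`) and the `t₀`-scheme re-based on it:
  `boundedFlowedEnergyObs r`, `FlowSchemeData.t0_eq_flowScaleTorus`,
  `FlowSchemeData.flowScaleTorus_spec`.

## Design choices

* Nothing in `LatticeWilsonFlow.lean` / `FlowScale.lean` is redefined: the bounded flow is a new
  definition next to `matrixWilsonFlow`, provably equal to it on finite lattices, so that consumers
  (and a later in-place refinement of `matrixWilsonFlow`) can switch by rewriting.
* Boundedness is stated entrywise (`‖Φ_t(e)ᵢⱼ‖ ≤ C`), like the entrywise derivatives of
  `IsWilsonFlowLine`, so the predicate is independent of a choice of matrix norm; proofs run in the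
  Frobenius norm (`Matrix.Norms.Frobenius`, the norm of the tree's `frobeniusInnerProductSpace`, for
  which `π_𝔤` has norm `≤ 1`). Local-in-time boundedness (rather than a global bound) makes the
  lift statements unconditional: the lift of ANY torus flow line is bounded on compact time
  intervals, no unitarity needed.
* The lift theorems hold for every `S ≥ 1`, `d`, `N`, `H`; existence of the torus flow line is
  never assumed (the junk branches of `boundedMatrixWilsonFlow` and `matrixWilsonFlow` correspond).

## Deliberately NOT here

Global existence of the torus flow line for unitary data and general `ρ` (Picard–Lindelöf plus
invariance of `ρ(G)^{links}`; done for `SU(n)` in `QuantumFieldTheory/WilsonFlow.lean`),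
unitarity along the flow, monotonicity of the Wilson action, continuity/measurability of
`U ↦ flowedEnergy ρ t x U` (needed to manipulate the profile integrals), and any bound on `t₀`.

## References

* M. Lüscher, *Properties and uses of the Wilson flow in lattice QCD*, JHEP 08 (2010) 071,
  arXiv:1006.4518 — eq. (1.4) (the flow), p. 2 (existence/uniqueness on a finite lattice),
  eq. (3.1) (the density `E`), §3.4 eq. (3.3) (`t₀`), §3.5 (b) (scale setting). [Luscher2010]
* O. E. Lanford, J. L. Lebowitz, E. H. Lieb, *Time evolution of infinite anharmonic systems*,
  J. Stat. Phys. 16 (1977) 453–461 (existence/uniqueness classes for infinite lattice dynamics;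
  the bounded class used here is the elementary case). [LanfordLebowitzLieb1977]
-/

noncomputable section

open scoped Matrix.Norms.Frobenius Nat Topology
open Matrix Set Filter

namespace Literature.MathematicalPhysics.QuantumLattice

attribute [local instance] frobeniusInnerProductSpace

/-! ### An abstract uniqueness lemma for infinite systems of ODEs -/

section AbstractODE

variable {ι E : Type*} [NormedAddCommGroup E] [NormedSpace ℝ E]

/-- **Uniqueness of bounded solutions of an infinite system of ODEs with uniformly Lipschitz
coupling** (Picard iteration estimate). Let `F : (ι → E) → (ι → E)` satisfy the sup-norm
Lipschitz estimate `‖F V i − F W i‖ ≤ K · δ` whenever all components of `V`, `W` have norm `≤ M`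
and all components of `V − W` have norm `≤ δ`. If `Φ, Ψ : ℝ → ι → E` solve `∂ₜ Φ_t(i) = F(Φ_t)(i)`
componentwise, agree at `t = 0`, and have all components bounded by `M` on `[0, T]`, then
`Φ_t = Ψ_t` on `[0, T]`: by induction `‖Φ_t(i) − Ψ_t(i)‖ ≤ 2M (Kt)ⁿ/n!` for every `n` (the
fencing theorem applied to each component, the bound on `F` feeding the previous step uniformly in
`i`), and `(Kt)ⁿ/n! → 0`. No measurability or continuity of `t ↦ supᵢ ‖Φ_t(i) − Ψ_t(i)‖` is needed.
(The classical argument for lattice dynamics, e.g. Lanford–Lebowitz–Lieb, J. Stat. Phys. 16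
(1977) §2, in the simplest — bounded — class.) [folklore] -/
theorem pi_ode_unique_of_bounded {F : (ι → E) → ι → E} {K M T : ℝ}
    (hF : ∀ V W : ι → E, (∀ i, ‖V i‖ ≤ M) → (∀ i, ‖W i‖ ≤ M) →
      ∀ δ : ℝ, (∀ i, ‖V i - W i‖ ≤ δ) → ∀ i, ‖F V i - F W i‖ ≤ K * δ)
    {Φ Ψ : ℝ → ι → E} (h0 : Φ 0 = Ψ 0)
    (hΦ : ∀ t i, HasDerivAt (fun s => Φ s i) (F (Φ t) i) t)
    (hΨ : ∀ t i, HasDerivAt (fun s => Ψ s i) (F (Ψ t) i) t)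
    (hΦM : ∀ t ∈ Icc 0 T, ∀ i, ‖Φ t i‖ ≤ M) (hΨM : ∀ t ∈ Icc 0 T, ∀ i, ‖Ψ t i‖ ≤ M)
    {t : ℝ} (ht : t ∈ Icc 0 T) : Φ t = Ψ t := by
  -- the Picard iteration bound
  have claim : ∀ n : ℕ, ∀ s ∈ Icc 0 T, ∀ i, ‖Φ s i - Ψ s i‖ ≤ 2 * M * (K * s) ^ n / n ! := by
    intro n
    induction n with
    | zero =>
      intro s hs i
      rw [pow_zero, Nat.factorial_zero, Nat.cast_one, div_one, mul_one, two_mul]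
      exact (norm_sub_le _ _).trans (add_le_add (hΦM s hs i) (hΨM s hs i))
    | succ n ih =>
      intro s hs i
      have hf : ContinuousOn (fun τ => Φ τ i - Ψ τ i) (Icc 0 T) := fun τ _ =>
        ((hΦ τ i).continuousAt.sub (hΨ τ i).continuousAt).continuousWithinAt
      have hf' : ∀ τ ∈ Ico 0 T,
          HasDerivWithinAt (fun τ => Φ τ i - Ψ τ i) (F (Φ τ) i - F (Ψ τ) i) (Ici τ) τ :=
        fun τ _ => ((hΦ τ i).sub (hΨ τ i)).hasDerivWithinAt
      set c : ℝ := 2 * M * K ^ (n + 1) with hc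
      have hB : ∀ τ : ℝ, HasDerivAt (fun τ : ℝ => c * τ ^ (n + 1) / ((n + 1)! : ℝ))
          (K * (2 * M * (K * τ) ^ n / (n ! : ℝ))) τ := by
        intro τ
        have h := ((hasDerivAt_pow (n + 1) τ).const_mul c).div_const ((n + 1)! : ℝ)
        refine h.congr_deriv ?_
        rw [Nat.factorial_succ, Nat.cast_mul, Nat.cast_succ, Nat.add_sub_cancel, hc]
        have hn : (n ! : ℝ) ≠ 0 := by positivity
        have hn1 : ((n : ℝ) + 1) ≠ 0 := by positivity
        field_simp
        ring
      have ha : ‖Φ 0 i - Ψ 0 i‖ ≤ c * (0 : ℝ) ^ (n + 1) / ((n + 1)! : ℝ) := by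
        simp [h0]
      have bound : ∀ τ ∈ Ico 0 T, ‖F (Φ τ) i - F (Ψ τ) i‖ ≤ K * (2 * M * (K * τ) ^ n / (n ! : ℝ)) :=
        fun τ hτ => hF (Φ τ) (Ψ τ) (hΦM τ (Ico_subset_Icc_self hτ)) (hΨM τ (Ico_subset_Icc_self hτ))
          _ (fun j => ih τ (Ico_subset_Icc_self hτ) j) i
      have key := image_norm_le_of_norm_deriv_right_le_deriv_boundary hf hf' ha hB bound hs
      calc ‖Φ s i - Ψ s i‖ ≤ c * s ^ (n + 1) / ((n + 1)! : ℝ) := key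
        _ = 2 * M * (K * s) ^ (n + 1) / ((n + 1)! : ℝ) := by rw [hc]; ring
  funext i
  have hlim : Tendsto (fun n : ℕ => 2 * M * ((K * t) ^ n / (n ! : ℝ))) atTop (𝓝 (2 * M * 0)) :=
    tendsto_const_nhds.mul (FloorSemiring.tendsto_pow_div_factorial_atTop (K * t))
  rw [mul_zero] at hlim
  have hle : ‖Φ t i - Ψ t i‖ ≤ 0 :=
    ge_of_tendsto' hlim fun n => by rw [← mul_div_assoc]; exact claim n t ht i
  exact sub_eq_zero.1 (norm_le_zero_iff.1 hle)

/-- The time-reversed form of `pi_ode_unique_of_bounded`: bounded componentwise solutions that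
agree at `t = 0` agree on `[−T, 0]` (apply the forward statement to `s ↦ Φ_{−s}` and the vector
field `−F`). [folklore] -/
theorem pi_ode_unique_of_bounded_neg {F : (ι → E) → ι → E} {K M T : ℝ}
    (hF : ∀ V W : ι → E, (∀ i, ‖V i‖ ≤ M) → (∀ i, ‖W i‖ ≤ M) →
      ∀ δ : ℝ, (∀ i, ‖V i - W i‖ ≤ δ) → ∀ i, ‖F V i - F W i‖ ≤ K * δ)
    {Φ Ψ : ℝ → ι → E} (h0 : Φ 0 = Ψ 0)
    (hΦ : ∀ t i, HasDerivAt (fun s => Φ s i) (F (Φ t) i) t)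
    (hΨ : ∀ t i, HasDerivAt (fun s => Ψ s i) (F (Ψ t) i) t)
    (hΦM : ∀ t ∈ Icc (-T) 0, ∀ i, ‖Φ t i‖ ≤ M) (hΨM : ∀ t ∈ Icc (-T) 0, ∀ i, ‖Ψ t i‖ ≤ M)
    {t : ℝ} (ht : t ∈ Icc (-T) 0) : Φ t = Ψ t := by
  have hF' : ∀ V W : ι → E, (∀ i, ‖V i‖ ≤ M) → (∀ i, ‖W i‖ ≤ M) →
      ∀ δ : ℝ, (∀ i, ‖V i - W i‖ ≤ δ) → ∀ i, ‖(-F V i) - (-F W i)‖ ≤ K * δ := by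
    intro V W hV hW δ hδ i
    rw [neg_sub_neg, norm_sub_rev]
    exact hF V W hV hW δ hδ i
  have hrev : ∀ {Θ : ℝ → ι → E}, (∀ t i, HasDerivAt (fun s => Θ s i) (F (Θ t) i) t) →
      ∀ t i, HasDerivAt (fun s => Θ (-s) i) (-F (Θ (-t)) i) t := by
    intro Θ hΘ t i
    have h := (hΘ (-t) i).scomp t (hasDerivAt_neg t)
    simpa [Function.comp_def] using h
  have key := pi_ode_unique_of_bounded (F := fun V i => -F V i) (T := T) hF'
    (Φ := fun s => Φ (-s)) (Ψ := fun s => Ψ (-s)) (by simpa using h0) (hrev hΦ) (hrev hΨ)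
    (fun s hs i => hΦM (-s) ⟨by linarith [hs.2], by linarith [hs.1]⟩ i)
    (fun s hs i => hΨM (-s) ⟨by linarith [hs.2], by linarith [hs.1]⟩ i)
    (t := -t) ⟨by linarith [ht.2], by linarith [ht.1]⟩
  simpa using key

end AbstractODE

/-! ### Frobenius-norm bookkeeping -/

section Frobenius

variable {N : ℕ}

/-- A matrix-valued curve all of whose entries are differentiable is differentiable for the
Frobenius norm (finite sum of scalar curves times constant matrices). [folklore] -/
theorem hasDerivAt_matrix_of_entries {f : ℝ → Matrix (Fin N) (Fin N) ℂ}
    {f' : Matrix (Fin N) (Fin N) ℂ} {t : ℝ}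
    (h : ∀ i j, HasDerivAt (fun τ => f τ i j) (f' i j) t) : HasDerivAt f f' t := by
  have key : HasDerivAt (fun τ => ∑ i, ∑ j, Matrix.single i j (f τ i j))
      (∑ i, ∑ j, Matrix.single i j (f' i j)) t := by
    refine HasDerivAt.fun_sum fun i _ => HasDerivAt.fun_sum fun j _ => ?_
    have hs : ∀ c : ℂ, Matrix.single i j c = c • Matrix.single i j (1 : ℂ) := fun c => by
      rw [Matrix.smul_single, smul_eq_mul, mul_one]
    simp only [hs (f _ i j), hs (f' i j)]
    exact (h i j).smul_const _
  have hf : (fun τ => ∑ i, ∑ j, Matrix.single i j (f τ i j)) = f :=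
    funext fun τ => (matrix_eq_sum_single (f τ)).symm
  rwa [hf, ← matrix_eq_sum_single f'] at key

/-- An entrywise bound `‖Aᵢⱼ‖ ≤ C` gives the Frobenius bound `‖A‖ ≤ N · C` (via the tree's
`frobenius_norm_sq_eq_sum`). [folklore] -/
theorem frobenius_norm_le_of_entry_le {A : Matrix (Fin N) (Fin N) ℂ} {C : ℝ} (hC : 0 ≤ C)
    (h : ∀ i j, ‖A i j‖ ≤ C) : ‖A‖ ≤ N * C := by
  have h2 : ‖A‖ ^ 2 ≤ ((N : ℝ) * C) ^ 2 := by
    rw [frobenius_norm_sq_eq_sum]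
    calc ∑ i, ∑ j, ‖A i j‖ ^ 2 ≤ ∑ _i : Fin N, ∑ _j : Fin N, C ^ 2 :=
          Finset.sum_le_sum fun i _ => Finset.sum_le_sum fun j _ =>
            pow_le_pow_left₀ (norm_nonneg _) (h i j) 2
      _ = ((N : ℝ) * C) ^ 2 := by
          simp only [Finset.sum_const, Finset.card_univ, Fintype.card_fin, nsmul_eq_mul]; ring
  exact (pow_le_pow_iff_left₀ (norm_nonneg _) (by positivity) two_ne_zero).1 h2

/-- `‖A B C D‖ ≤ ‖A‖ ‖B‖ ‖C‖ ‖D‖` (Frobenius norm is submultiplicative). [folklore] -/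
theorem frobenius_norm_mul₄_le (A B C D : Matrix (Fin N) (Fin N) ℂ) :
    ‖A * B * C * D‖ ≤ ‖A‖ * ‖B‖ * ‖C‖ * ‖D‖ :=
  (norm_mul_le _ _).trans <| mul_le_mul_of_nonneg_right
    ((norm_mul_le _ _).trans <| mul_le_mul_of_nonneg_right (norm_mul_le _ _) (norm_nonneg _))
    (norm_nonneg _)

/-- Monotonicity of a product of four nonnegative reals. [folklore] -/
private theorem mul₄_le_mul₄ {a b c e A B C E : ℝ} (ha : 0 ≤ a) (hb : 0 ≤ b) (hc : 0 ≤ c)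
    (he : 0 ≤ e) (hA : a ≤ A) (hB : b ≤ B) (hC : c ≤ C) (hE : e ≤ E) :
    a * b * c * e ≤ A * B * C * E := by
  have hA0 : 0 ≤ A := ha.trans hA
  have hB0 : 0 ≤ B := hb.trans hB
  have hC0 : 0 ≤ C := hc.trans hC
  exact mul_le_mul (mul_le_mul (mul_le_mul hA hB hb hA0) hC hc (mul_nonneg hA0 hB0)) hE he
    (mul_nonneg (mul_nonneg hA0 hB0) hC0)

/-- Telescoping estimate for a product of four matrices in the ball of radius `M`:
`‖A₁A₂A₃A₄ − B₁B₂B₃B₄‖ ≤ 4 M³ δ` when `‖Aₖ − Bₖ‖ ≤ δ`. [folklore] -/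
theorem frobenius_norm_mul₄_sub_mul₄_le {A₁ A₂ A₃ A₄ B₁ B₂ B₃ B₄ : Matrix (Fin N) (Fin N) ℂ}
    {M δ : ℝ} (h₂ : ‖A₂‖ ≤ M) (h₃ : ‖A₃‖ ≤ M) (h₄ : ‖A₄‖ ≤ M)
    (g₁ : ‖B₁‖ ≤ M) (g₂ : ‖B₂‖ ≤ M) (g₃ : ‖B₃‖ ≤ M)
    (d₁ : ‖A₁ - B₁‖ ≤ δ) (d₂ : ‖A₂ - B₂‖ ≤ δ) (d₃ : ‖A₃ - B₃‖ ≤ δ) (d₄ : ‖A₄ - B₄‖ ≤ δ) :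
    ‖A₁ * A₂ * A₃ * A₄ - B₁ * B₂ * B₃ * B₄‖ ≤ 4 * M ^ 3 * δ := by
  have key : A₁ * A₂ * A₃ * A₄ - B₁ * B₂ * B₃ * B₄ =
      (A₁ - B₁) * A₂ * A₃ * A₄ + B₁ * (A₂ - B₂) * A₃ * A₄ + B₁ * B₂ * (A₃ - B₃) * A₄ +
        B₁ * B₂ * B₃ * (A₄ - B₄) := by
    noncomm_ring
  rw [key]
  have t1 : ‖(A₁ - B₁) * A₂ * A₃ * A₄‖ ≤ δ * M * M * M :=
    (frobenius_norm_mul₄_le _ _ _ _).trans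
      (mul₄_le_mul₄ (norm_nonneg _) (norm_nonneg _) (norm_nonneg _) (norm_nonneg _) d₁ h₂ h₃ h₄)
  have t2 : ‖B₁ * (A₂ - B₂) * A₃ * A₄‖ ≤ M * δ * M * M :=
    (frobenius_norm_mul₄_le _ _ _ _).trans
      (mul₄_le_mul₄ (norm_nonneg _) (norm_nonneg _) (norm_nonneg _) (norm_nonneg _) g₁ d₂ h₃ h₄)
  have t3 : ‖B₁ * B₂ * (A₃ - B₃) * A₄‖ ≤ M * M * δ * M :=
    (frobenius_norm_mul₄_le _ _ _ _).trans
      (mul₄_le_mul₄ (norm_nonneg _) (norm_nonneg _) (norm_nonneg _) (norm_nonneg _) g₁ g₂ d₃ h₄)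
  have t4 : ‖B₁ * B₂ * B₃ * (A₄ - B₄)‖ ≤ M * M * M * δ :=
    (frobenius_norm_mul₄_le _ _ _ _).trans
      (mul₄_le_mul₄ (norm_nonneg _) (norm_nonneg _) (norm_nonneg _) (norm_nonneg _) g₁ g₂ g₃ d₄)
  calc _ ≤ ‖(A₁ - B₁) * A₂ * A₃ * A₄‖ + ‖B₁ * (A₂ - B₂) * A₃ * A₄‖ +
        ‖B₁ * B₂ * (A₃ - B₃) * A₄‖ + ‖B₁ * B₂ * B₃ * (A₄ - B₄)‖ :=
        (norm_add_le _ _).trans (add_le_add (norm_add₃_le) le_rfl)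
    _ ≤ δ * M * M * M + M * δ * M * M + M * M * δ * M + M * M * M * δ :=
        add_le_add (add_le_add (add_le_add t1 t2) t3) t4
    _ = 4 * M ^ 3 * δ := by ring

end Frobenius

/-! ### Bounds for the Wilson-flow vector field -/

section FieldBounds

variable {d : ℕ} {R : Type*} [AddGroup R] [One R] {N : ℕ}

/-- The projector `π_𝔤` is norm non-increasing (orthogonal projection for the Hilbert–Schmidt
inner product). [folklore] -/
theorem norm_lieProjection_le (H : Set (Matrix (Fin N) (Fin N) ℂ)) (W : Matrix (Fin N) (Fin N) ℂ) :
    ‖lieProjection H W‖ ≤ ‖W‖ :=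
  Submodule.norm_starProjection_apply_le (matrixLieAlgebra H) W

/-- **A priori bound on the plaquette sum**: `‖Ω_e(V)‖ ≤ 2d M⁴` when every link matrix has
Frobenius norm `≤ M`. [folklore] -/
theorem norm_plaquetteSum_le {M : ℝ} {V : MatrixLinkField d R N} (hV : ∀ e, ‖V e‖ ≤ M)
    (e : (Fin d → R) × Fin d) : ‖plaquetteSum V e‖ ≤ 2 * d * M ^ 4 := by
  have hM : 0 ≤ M := (norm_nonneg _).trans (hV e)
  have hVc : ∀ e, ‖(V e)ᴴ‖ ≤ M := fun e => by rw [frobenius_norm_conjTranspose]; exact hV e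
  have hprod : ∀ A B C D : Matrix (Fin N) (Fin N) ℂ, ‖A‖ ≤ M → ‖B‖ ≤ M → ‖C‖ ≤ M → ‖D‖ ≤ M →
      ‖A * B * C * D‖ ≤ M ^ 4 := fun A B C D hA hB hC hD =>
    calc ‖A * B * C * D‖ ≤ ‖A‖ * ‖B‖ * ‖C‖ * ‖D‖ := frobenius_norm_mul₄_le A B C D
      _ ≤ M * M * M * M :=
        mul₄_le_mul₄ (norm_nonneg _) (norm_nonneg _) (norm_nonneg _) (norm_nonneg _) hA hB hC hD
      _ = M ^ 4 := by ring
  unfold plaquetteSum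
  refine (norm_sum_le _ _).trans ?_
  calc ∑ ν : Fin d, ‖(if ν = e.2 then (0 : Matrix (Fin N) (Fin N) ℂ) else
          (V e * V (e.1 + Pi.single e.2 1, ν) * (V (e.1 + Pi.single ν 1, e.2))ᴴ * (V (e.1, ν))ᴴ +
            V e * (V (e.1 + Pi.single e.2 1 - Pi.single ν 1, ν))ᴴ *
              (V (e.1 - Pi.single ν 1, e.2))ᴴ * V (e.1 - Pi.single ν 1, ν)))‖
        ≤ ∑ _ν : Fin d, 2 * M ^ 4 := by
        refine Finset.sum_le_sum fun ν _ => ?_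
        split_ifs
        · rw [norm_zero]; positivity
        · refine (norm_add_le _ _).trans ?_
          refine (add_le_add (hprod _ _ _ _ ?_ ?_ ?_ ?_) (hprod _ _ _ _ ?_ ?_ ?_ ?_)).trans_eq
            (by ring)
          exacts [hV _, hV _, hVc _, hVc _, hV _, hVc _, hVc _, hV _]
    _ = 2 * d * M ^ 4 := by
        simp only [Finset.sum_const, Finset.card_univ, Fintype.card_fin, nsmul_eq_mul]; ring

/-- **Lipschitz estimate for the plaquette sum on the `M`-ball**:
`‖Ω_e(V) − Ω_e(W)‖ ≤ 8d M³ δ` when all link matrices have norm `≤ M` and differ by `≤ δ`. [folklore] -/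
theorem norm_plaquetteSum_sub_le {M δ : ℝ} {V W : MatrixLinkField d R N} (hV : ∀ e, ‖V e‖ ≤ M)
    (hW : ∀ e, ‖W e‖ ≤ M) (hδ : ∀ e, ‖V e - W e‖ ≤ δ) (e : (Fin d → R) × Fin d) :
    ‖plaquetteSum V e - plaquetteSum W e‖ ≤ 8 * d * M ^ 3 * δ := by
  have hM : 0 ≤ M := (norm_nonneg _).trans (hV e)
  have hδ0 : 0 ≤ δ := (norm_nonneg _).trans (hδ e)
  have hVc : ∀ e, ‖(V e)ᴴ‖ ≤ M := fun e => by rw [frobenius_norm_conjTranspose]; exact hV e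
  have hWc : ∀ e, ‖(W e)ᴴ‖ ≤ M := fun e => by rw [frobenius_norm_conjTranspose]; exact hW e
  have hδc : ∀ e, ‖(V e)ᴴ - (W e)ᴴ‖ ≤ δ := fun e => by
    rw [← conjTranspose_sub, frobenius_norm_conjTranspose]; exact hδ e
  unfold plaquetteSum
  rw [← Finset.sum_sub_distrib]
  refine (norm_sum_le _ _).trans ?_
  calc ∑ ν : Fin d, ‖(if ν = e.2 then (0 : Matrix (Fin N) (Fin N) ℂ) else
          (V e * V (e.1 + Pi.single e.2 1, ν) * (V (e.1 + Pi.single ν 1, e.2))ᴴ * (V (e.1, ν))ᴴ +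
            V e * (V (e.1 + Pi.single e.2 1 - Pi.single ν 1, ν))ᴴ *
              (V (e.1 - Pi.single ν 1, e.2))ᴴ * V (e.1 - Pi.single ν 1, ν))) -
          (if ν = e.2 then (0 : Matrix (Fin N) (Fin N) ℂ) else
          (W e * W (e.1 + Pi.single e.2 1, ν) * (W (e.1 + Pi.single ν 1, e.2))ᴴ * (W (e.1, ν))ᴴ +
            W e * (W (e.1 + Pi.single e.2 1 - Pi.single ν 1, ν))ᴴ *
              (W (e.1 - Pi.single ν 1, e.2))ᴴ * W (e.1 - Pi.single ν 1, ν)))‖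
        ≤ ∑ _ν : Fin d, 8 * M ^ 3 * δ := by
        refine Finset.sum_le_sum fun ν _ => ?_
        split_ifs
        · rw [sub_zero, norm_zero]
          exact mul_nonneg (mul_nonneg (by norm_num) (pow_nonneg hM 3)) hδ0
        · rw [add_sub_add_comm]
          refine (norm_add_le _ _).trans ?_
          refine (add_le_add
            (frobenius_norm_mul₄_sub_mul₄_le (M := M) (δ := δ) ?_ ?_ ?_ ?_ ?_ ?_ ?_ ?_ ?_ ?_)
            (frobenius_norm_mul₄_sub_mul₄_le (M := M) (δ := δ)
              ?_ ?_ ?_ ?_ ?_ ?_ ?_ ?_ ?_ ?_)).trans_eq (by ring)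
          exacts [hV _, hVc _, hVc _, hW _, hW _, hWc _, hδ _, hδ _, hδc _, hδc _,
            hVc _, hVc _, hV _, hW _, hWc _, hWc _, hδ _, hδc _, hδc _, hδ _]
    _ = 8 * d * M ^ 3 * δ := by
        simp only [Finset.sum_const, Finset.card_univ, Fintype.card_fin, nsmul_eq_mul]; ring

/-- **A priori bound on the flow vector field**: `‖Z(V)(e) V(e)‖ ≤ 2d M⁵`. [folklore] -/
theorem norm_wilsonFlowField_le (H : Set (Matrix (Fin N) (Fin N) ℂ)) {M : ℝ}
    {V : MatrixLinkField d R N} (hV : ∀ e, ‖V e‖ ≤ M) (e : (Fin d → R) × Fin d) :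
    ‖wilsonFlowField H V e‖ ≤ 2 * d * M ^ 5 := by
  have hM : 0 ≤ M := (norm_nonneg _).trans (hV e)
  rw [wilsonFlowField, wilsonFlowGenerator, neg_mul, norm_neg]
  calc _ ≤ ‖lieProjection H (plaquetteSum V e)‖ * ‖V e‖ := norm_mul_le _ _
    _ ≤ (2 * d * M ^ 4) * M :=
        mul_le_mul ((norm_lieProjection_le H _).trans (norm_plaquetteSum_le hV e)) (hV e)
          (norm_nonneg _) (by positivity)
    _ = 2 * d * M ^ 5 := by ring

/-- **Lipschitz estimate for the flow vector field on the `M`-ball, uniformly over links**: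
`‖Z(V)(e)V(e) − Z(W)(e)W(e)‖ ≤ 10 d M⁴ δ` when all link matrices of `V`, `W` have Frobenius
norm `≤ M` and `‖V(e') − W(e')‖ ≤ δ` for all links `e'` (finite range: only the `2(d−1)`
plaquettes through `e` enter, but the uniform form is all that is used). [folklore] -/
theorem norm_wilsonFlowField_sub_le (H : Set (Matrix (Fin N) (Fin N) ℂ)) {M δ : ℝ}
    {V W : MatrixLinkField d R N} (hV : ∀ e, ‖V e‖ ≤ M) (hW : ∀ e, ‖W e‖ ≤ M)
    (hδ : ∀ e, ‖V e - W e‖ ≤ δ) (e : (Fin d → R) × Fin d) :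
    ‖wilsonFlowField H V e - wilsonFlowField H W e‖ ≤ 10 * d * M ^ 4 * δ := by
  have hM : 0 ≤ M := (norm_nonneg _).trans (hV e)
  have hδ0 : 0 ≤ δ := (norm_nonneg _).trans (hδ e)
  have hsplit : wilsonFlowField H V e - wilsonFlowField H W e =
      -(lieProjection H (plaquetteSum V e) * (V e - W e) +
        lieProjection H (plaquetteSum V e - plaquetteSum W e) * W e) := by
    simp only [wilsonFlowField, wilsonFlowGenerator, map_sub, Matrix.mul_sub, Matrix.sub_mul,
      neg_mul]
    abel
  rw [hsplit, norm_neg]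
  refine (norm_add_le _ _).trans ?_
  have h1 : ‖lieProjection H (plaquetteSum V e) * (V e - W e)‖ ≤ 2 * d * M ^ 4 * δ :=
    (norm_mul_le _ _).trans (mul_le_mul ((norm_lieProjection_le H _).trans
      (norm_plaquetteSum_le hV e)) (hδ e) (norm_nonneg _) (by positivity))
  have h2 : ‖lieProjection H (plaquetteSum V e - plaquetteSum W e) * W e‖ ≤
      8 * d * M ^ 3 * δ * M :=
    (norm_mul_le _ _).trans (mul_le_mul ((norm_lieProjection_le H _).trans
      (norm_plaquetteSum_sub_le hV hW hδ e)) (hW e) (norm_nonneg _)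
      (mul_nonneg (mul_nonneg (mul_nonneg (by norm_num) (Nat.cast_nonneg d)) (pow_nonneg hM 3))
        hδ0))
  calc _ ≤ 2 * d * M ^ 4 * δ + 8 * d * M ^ 3 * δ * M := add_le_add h1 h2
    _ = 10 * d * M ^ 4 * δ := by ring

end FieldBounds

/-! ### Bounded flow lines: definition, uniqueness, the bounded flow -/

section Bounded

variable {d : ℕ} {R : Type*} [AddGroup R] [One R] {N : ℕ}

/-- **A bounded Wilson flow line** from `V`: a global flow line `Φ` of (1.4) (the tree's
`IsWilsonFlowLine H V Φ`, entrywise derivatives at every real time) whose link matrices are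
**uniformly bounded over all links, locally uniformly in time**: for every `T` there is `C` with
`‖Φ_t(e)ᵢⱼ‖ ≤ C` for all `|t| ≤ T`, all links `e` and all entries. On a finite lattice every flow
line is bounded (`IsWilsonFlowLine.isBounded`); on `ℤ^d` this is the class in which (1.4) is well
posed — flow lines of (1.4) on the infinite lattice are NOT unique without a growth condition
(solve the link equations outward from prescribed data, as for the lattice heat equation), but
bounded ones are (`IsBoundedWilsonFlowLine.unique`), and for periodic data the bounded flow line
is the periodic extension of the torus flow (`boundedMatrixWilsonFlow_comp_torusEdge`), which is
the object of [Luscher2010] (finite lattice, periodic boundary conditions, p. 2). [cite: Luscher2010, eq. (1.4)] -/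
def IsBoundedWilsonFlowLine (H : Set (Matrix (Fin N) (Fin N) ℂ)) (V : MatrixLinkField d R N)
    (Φ : ℝ → MatrixLinkField d R N) : Prop :=
  IsWilsonFlowLine H V Φ ∧
    ∀ T : ℝ, ∃ C : ℝ, ∀ t ∈ Icc (-T) T, ∀ (e : (Fin d → R) × Fin d) (i j : Fin N), ‖Φ t e i j‖ ≤ C

/-- A bounded flow line is a flow line. [folklore] -/
theorem IsBoundedWilsonFlowLine.isWilsonFlowLine {H : Set (Matrix (Fin N) (Fin N) ℂ)}
    {V : MatrixLinkField d R N} {Φ : ℝ → MatrixLinkField d R N}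
    (h : IsBoundedWilsonFlowLine H V Φ) : IsWilsonFlowLine H V Φ :=
  h.1

/-- The Frobenius form of the boundedness clause: on `[−T, T]` all link matrices of a bounded flow
line have Frobenius norm `≤ M` for some `M ≥ 0`. [folklore] -/
theorem IsBoundedWilsonFlowLine.exists_norm_le {H : Set (Matrix (Fin N) (Fin N) ℂ)}
    {V : MatrixLinkField d R N} {Φ : ℝ → MatrixLinkField d R N}
    (h : IsBoundedWilsonFlowLine H V Φ) (T : ℝ) :
    ∃ M : ℝ, 0 ≤ M ∧ ∀ t ∈ Icc (-T) T, ∀ e, ‖Φ t e‖ ≤ M := by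
  obtain ⟨C, hC⟩ := h.2 T
  refine ⟨N * max C 0, by positivity, fun t ht e => ?_⟩
  exact frobenius_norm_le_of_entry_le (le_max_right _ _)
    fun i j => (hC t ht e i j).trans (le_max_left _ _)

/-- A flow line, read link by link in the ambient matrix space, solves the ODE for the Frobenius
norm. [folklore] -/
theorem IsWilsonFlowLine.hasDerivAt {H : Set (Matrix (Fin N) (Fin N) ℂ)}
    {V : MatrixLinkField d R N} {Φ : ℝ → MatrixLinkField d R N} (h : IsWilsonFlowLine H V Φ)
    (t : ℝ) (e : (Fin d → R) × Fin d) :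
    HasDerivAt (fun s => Φ s e) (wilsonFlowField H (Φ t) e) t :=
  hasDerivAt_matrix_of_entries fun i j => h.2 t e i j

/-- **Uniqueness of bounded flow lines** (any site type `R`, in particular `ℤ^d`): two bounded
flow lines of (1.4) from the same initial field coincide at all real times. Proof: on `[−T, T]`
both stay in a Frobenius ball of radius `M`, on which the vector field is `10dM⁴`-Lipschitz for the
sup norm over links (`norm_wilsonFlowField_sub_le`); conclude by `pi_ode_unique_of_bounded` and its
time reversal. [folklore] -/
theorem IsBoundedWilsonFlowLine.unique {H : Set (Matrix (Fin N) (Fin N) ℂ)}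
    {V : MatrixLinkField d R N} {Φ Ψ : ℝ → MatrixLinkField d R N}
    (hΦ : IsBoundedWilsonFlowLine H V Φ) (hΨ : IsBoundedWilsonFlowLine H V Ψ) : Φ = Ψ := by
  funext t
  obtain ⟨M₁, hM₁, hΦM⟩ := hΦ.exists_norm_le |t|
  obtain ⟨M₂, hM₂, hΨM⟩ := hΨ.exists_norm_le |t|
  set M := max M₁ M₂
  have hΦM' : ∀ s ∈ Icc (-|t|) |t|, ∀ e, ‖Φ s e‖ ≤ M := fun s hs e =>
    (hΦM s hs e).trans (le_max_left _ _)
  have hΨM' : ∀ s ∈ Icc (-|t|) |t|, ∀ e, ‖Ψ s e‖ ≤ M := fun s hs e =>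
    (hΨM s hs e).trans (le_max_right _ _)
  have hF : ∀ V W : MatrixLinkField d R N, (∀ e, ‖V e‖ ≤ M) → (∀ e, ‖W e‖ ≤ M) →
      ∀ δ : ℝ, (∀ e, ‖V e - W e‖ ≤ δ) →
        ∀ e, ‖wilsonFlowField H V e - wilsonFlowField H W e‖ ≤ (10 * d * M ^ 4) * δ :=
    fun V W hV hW δ hδ e => norm_wilsonFlowField_sub_le H hV hW hδ e
  have h0 : Φ 0 = Ψ 0 := by rw [hΦ.1.1, hΨ.1.1]
  rcases le_total 0 t with ht | ht
  · exact pi_ode_unique_of_bounded (T := |t|) hF h0 hΦ.1.hasDerivAt hΨ.1.hasDerivAt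
      (fun s hs e => hΦM' s ⟨by linarith [hs.1, abs_nonneg t], hs.2⟩ e)
      (fun s hs e => hΨM' s ⟨by linarith [hs.1, abs_nonneg t], hs.2⟩ e) ⟨ht, le_abs_self t⟩
  · exact pi_ode_unique_of_bounded_neg (T := |t|) hF h0 hΦ.1.hasDerivAt hΨ.1.hasDerivAt
      (fun s hs e => hΦM' s ⟨hs.1, by linarith [hs.2, abs_nonneg t]⟩ e)
      (fun s hs e => hΨM' s ⟨hs.1, by linarith [hs.2, abs_nonneg t]⟩ e)
      ⟨by rw [abs_of_nonpos ht]; linarith, ht⟩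

open Classical in
/-- **The bounded Wilson flow at the matrix level**, `V ↦ V_t`: the value at flow time `t` of
the bounded flow line of (1.4) from `V` — unique whenever it exists
(`IsBoundedWilsonFlowLine.unique`) — with the documented junk value `V` (constant field) when no
bounded flow line exists. On a finite lattice this is the tree's `matrixWilsonFlow`
(`boundedMatrixWilsonFlow_eq_matrixWilsonFlow`); on `ℤ^d` it is the flow to use: for periodic data
it is the periodic extension of the torus flow (`boundedMatrixWilsonFlow_comp_torusEdge`), whereas
`matrixWilsonFlow` picks an unspecified, possibly unbounded, flow line. [cite: Luscher2010, eq. (1.4)] -/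
def boundedMatrixWilsonFlow (H : Set (Matrix (Fin N) (Fin N) ℂ)) (t : ℝ)
    (V : MatrixLinkField d R N) : MatrixLinkField d R N :=
  if h : ∃ Φ, IsBoundedWilsonFlowLine H V Φ then h.choose t else V

/-- At flow time `0` the bounded flow is the identity (both branches). [cite: Luscher2010, eq. (1.4)] -/
@[simp]
theorem boundedMatrixWilsonFlow_zero (H : Set (Matrix (Fin N) (Fin N) ℂ))
    (V : MatrixLinkField d R N) : boundedMatrixWilsonFlow H 0 V = V := by
  unfold boundedMatrixWilsonFlow
  split_ifs with h
  · exact h.choose_spec.1.1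
  · rfl

/-- Whenever a bounded flow line from `V` exists, `t ↦ boundedMatrixWilsonFlow H t V` is one
(hence THE one). [folklore] -/
theorem isBoundedWilsonFlowLine_boundedMatrixWilsonFlow {H : Set (Matrix (Fin N) (Fin N) ℂ)}
    {V : MatrixLinkField d R N} (h : ∃ Φ, IsBoundedWilsonFlowLine H V Φ) :
    IsBoundedWilsonFlowLine H V fun t => boundedMatrixWilsonFlow H t V := by
  have hfun : (fun t => boundedMatrixWilsonFlow H t V) = h.choose := by
    funext t
    exact dif_pos h
  rw [hfun]
  exact h.choose_spec

/-- The junk branch: with no bounded flow line the bounded flow is the constant field. [folklore] -/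
theorem boundedMatrixWilsonFlow_of_not_exists {H : Set (Matrix (Fin N) (Fin N) ℂ)}
    {V : MatrixLinkField d R N} (h : ¬ ∃ Φ, IsBoundedWilsonFlowLine H V Φ) (t : ℝ) :
    boundedMatrixWilsonFlow H t V = V :=
  dif_neg h

/-- **Every bounded flow line is the bounded flow**: `Φ_t = boundedMatrixWilsonFlow H t V`. [folklore] -/
theorem IsBoundedWilsonFlowLine.eq_boundedMatrixWilsonFlow {H : Set (Matrix (Fin N) (Fin N) ℂ)}
    {V : MatrixLinkField d R N} {Φ : ℝ → MatrixLinkField d R N}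
    (hΦ : IsBoundedWilsonFlowLine H V Φ) (t : ℝ) : Φ t = boundedMatrixWilsonFlow H t V :=
  congr_fun (hΦ.unique (isBoundedWilsonFlowLine_boundedMatrixWilsonFlow ⟨Φ, hΦ⟩)) t

/-- **On a finite lattice every flow line is bounded**: finitely many continuous entries on the
compact interval `[−T, T]`. [folklore] -/
theorem IsWilsonFlowLine.isBounded [Finite R] {H : Set (Matrix (Fin N) (Fin N) ℂ)}
    {V : MatrixLinkField d R N} {Φ : ℝ → MatrixLinkField d R N} (h : IsWilsonFlowLine H V Φ) :
    IsBoundedWilsonFlowLine H V Φ := by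
  refine ⟨h, fun T => ?_⟩
  haveI : Fintype R := Fintype.ofFinite R
  let g : ℝ → ((Fin d → R) × Fin d) × Fin N × Fin N → ℂ := fun s k => Φ s k.1 k.2.1 k.2.2
  have hg : Continuous g :=
    continuous_pi fun k =>
      continuous_iff_continuousAt.2 fun s => (h.2 s k.1 k.2.1 k.2.2).continuousAt
  obtain ⟨C, hC⟩ := (isCompact_Icc (a := -T) (b := T)).exists_bound_of_continuousOn hg.continuousOn
  exact ⟨C, fun t ht e i j => (norm_le_pi_norm (g t) (e, i, j)).trans (hC t ht)⟩

/-- **Uniqueness of flow lines on a finite lattice** (e.g. the discrete torus, `R = ZMod L`):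
finite-dimensional ODE uniqueness, here as a corollary of the bounded case. [cite: Luscher2010, §1 p. 2] -/
theorem IsWilsonFlowLine.unique_of_finite [Finite R] {H : Set (Matrix (Fin N) (Fin N) ℂ)}
    {V : MatrixLinkField d R N} {Φ Ψ : ℝ → MatrixLinkField d R N}
    (hΦ : IsWilsonFlowLine H V Φ) (hΨ : IsWilsonFlowLine H V Ψ) : Φ = Ψ :=
  hΦ.isBounded.unique hΨ.isBounded

/-- On a finite lattice a flow line exists iff a bounded one does. [folklore] -/
theorem exists_isBoundedWilsonFlowLine_iff_of_finite [Finite R]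
    (H : Set (Matrix (Fin N) (Fin N) ℂ)) (V : MatrixLinkField d R N) :
    (∃ Φ, IsBoundedWilsonFlowLine H V Φ) ↔ ∃ Φ, IsWilsonFlowLine H V Φ :=
  ⟨fun ⟨Φ, hΦ⟩ => ⟨Φ, hΦ.1⟩, fun ⟨Φ, hΦ⟩ => ⟨Φ, hΦ.isBounded⟩⟩

/-- **On a finite lattice the bounded flow is the tree's flow**:
`boundedMatrixWilsonFlow H t V = matrixWilsonFlow H t V` (both are the unique flow line when one
exists, both are the junk value `V` otherwise). [folklore] -/
theorem boundedMatrixWilsonFlow_eq_matrixWilsonFlow [Finite R] (H : Set (Matrix (Fin N) (Fin N) ℂ))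
    (t : ℝ) (V : MatrixLinkField d R N) :
    boundedMatrixWilsonFlow H t V = matrixWilsonFlow H t V := by
  by_cases h : ∃ Φ, IsWilsonFlowLine H V Φ
  · have hb : ∃ Φ, IsBoundedWilsonFlowLine H V Φ :=
      (exists_isBoundedWilsonFlowLine_iff_of_finite H V).2 h
    exact congr_fun ((isBoundedWilsonFlowLine_boundedMatrixWilsonFlow hb).1.unique_of_finite
      (isWilsonFlowLine_matrixWilsonFlow h)) t
  · have hb : ¬ ∃ Φ, IsBoundedWilsonFlowLine H V Φ :=
      fun hb => h ((exists_isBoundedWilsonFlowLine_iff_of_finite H V).1 hb)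
    rw [boundedMatrixWilsonFlow_of_not_exists hb, matrixWilsonFlow, dif_neg h]

/-- Any flow line on a finite lattice is the tree's flow: `Φ_t = matrixWilsonFlow H t V`. [folklore] -/
theorem IsWilsonFlowLine.eq_matrixWilsonFlow [Finite R] {H : Set (Matrix (Fin N) (Fin N) ℂ)}
    {V : MatrixLinkField d R N} {Φ : ℝ → MatrixLinkField d R N} (hΦ : IsWilsonFlowLine H V Φ)
    (t : ℝ) : Φ t = matrixWilsonFlow H t V := by
  rw [← boundedMatrixWilsonFlow_eq_matrixWilsonFlow]
  exact hΦ.isBounded.eq_boundedMatrixWilsonFlow t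

end Bounded

/-! ### Changing the site type: periodic lifts and translations -/

section Comp

variable {d : ℕ} {R R' : Type*} [AddGroup R] [One R] [AddGroup R'] [One R'] {N : ℕ}

/-- A map of site types is **shift compatible** when it commutes with the unit shifts
`x ↦ x ± μ̂`; examples: the reduction `Torus.proj S : ℤ^d → (ℤ/Sℤ)^d` and the translations
`x ↦ x + a` of `ℤ^d`. Such a map `f` acts on links by `Prod.map f id` and on link fields by
precomposition. [folklore] -/
def IsShiftCompatible (f : (Fin d → R) → (Fin d → R')) : Prop :=
  ∀ (x : Fin d → R) (μ : Fin d),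
    f (x + Pi.single μ 1) = f x + Pi.single μ 1 ∧ f (x - Pi.single μ 1) = f x - Pi.single μ 1

/-- The reduction modulo `S`, `Torus.proj S : ℤ^d → (ℤ/Sℤ)^d`, is shift compatible. [folklore] -/
theorem isShiftCompatible_torusProj (S : ℕ) :
    IsShiftCompatible (Literature.Probability.LatticeModels.Torus.proj (d := d) S) := by
  intro x μ
  constructor
  · funext i
    by_cases h : i = μ
    · subst h; simp
    · simp [h]
  · funext i
    by_cases h : i = μ
    · subst h; simp
    · simp [h]

/-- Translations `x ↦ x + a` of a commutative site group are shift compatible. [folklore] -/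
theorem isShiftCompatible_add_const {R : Type*} [AddCommGroup R] [One R] (a : Fin d → R) :
    IsShiftCompatible (fun x : Fin d → R => x + a) := fun x μ =>
  ⟨add_right_comm x (Pi.single μ 1) a, sub_add_eq_add_sub x (Pi.single μ 1) a⟩

/-- The plaquette sum commutes with shift-compatible changes of site type:
`Ω_e(V ∘ f) = Ω_{f e}(V)`. [folklore] -/
theorem plaquetteSum_comp {f : (Fin d → R) → (Fin d → R')} (hf : IsShiftCompatible f)
    (V : MatrixLinkField d R' N) (e : (Fin d → R) × Fin d) :
    plaquetteSum (V ∘ Prod.map f id) e = plaquetteSum V (Prod.map f id e) := by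
  have h1 : ∀ x μ, f (x + Pi.single μ 1) = f x + Pi.single μ 1 := fun x μ => (hf x μ).1
  have h2 : ∀ x μ, f (x - Pi.single μ 1) = f x - Pi.single μ 1 := fun x μ => (hf x μ).2
  simp only [plaquetteSum, Function.comp_apply, Prod.map_apply, Prod.map_fst, Prod.map_snd, id_eq,
    h1, h2]

/-- The flow vector field commutes with shift-compatible changes of site type. [folklore] -/
theorem wilsonFlowField_comp (H : Set (Matrix (Fin N) (Fin N) ℂ)) {f : (Fin d → R) → (Fin d → R')}
    (hf : IsShiftCompatible f) (V : MatrixLinkField d R' N) :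
    wilsonFlowField H (V ∘ Prod.map f id) = wilsonFlowField H V ∘ Prod.map f id := by
  funext e
  simp only [wilsonFlowField, wilsonFlowGenerator, Function.comp_apply, plaquetteSum_comp hf]

/-- Flow lines pull back along shift-compatible changes of site type (e.g. the periodic lift of
a torus flow line is a flow line on `ℤ^d`). [folklore] -/
theorem IsWilsonFlowLine.comp {H : Set (Matrix (Fin N) (Fin N) ℂ)} {f : (Fin d → R) → (Fin d → R')}
    (hf : IsShiftCompatible f) {V : MatrixLinkField d R' N} {Φ : ℝ → MatrixLinkField d R' N}
    (h : IsWilsonFlowLine H V Φ) :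
    IsWilsonFlowLine H (V ∘ Prod.map f id) fun t => Φ t ∘ Prod.map f id := by
  refine ⟨?_, fun t e i j => ?_⟩
  · show Φ 0 ∘ Prod.map f id = V ∘ Prod.map f id
    rw [h.1]
  · rw [wilsonFlowField_comp H hf]
    exact h.2 t (Prod.map f id e) i j

/-- Bounded flow lines pull back along shift-compatible changes of site type. [folklore] -/
theorem IsBoundedWilsonFlowLine.comp {H : Set (Matrix (Fin N) (Fin N) ℂ)}
    {f : (Fin d → R) → (Fin d → R')} (hf : IsShiftCompatible f) {V : MatrixLinkField d R' N}
    {Φ : ℝ → MatrixLinkField d R' N} (h : IsBoundedWilsonFlowLine H V Φ) :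
    IsBoundedWilsonFlowLine H (V ∘ Prod.map f id) fun t => Φ t ∘ Prod.map f id := by
  refine ⟨h.1.comp hf, fun T => ?_⟩
  obtain ⟨C, hC⟩ := h.2 T
  exact ⟨C, fun t ht e i j => hC t ht _ i j⟩

/-- **Lattice-translation covariance of the bounded flow** (commutative site group, e.g. `ℤ^d`
or the torus): `(V ∘ τ_a)_t = V_t ∘ τ_a` for the translation `τ_a (x, μ) = (x + a, μ)` — by
uniqueness of bounded flow lines (the junk branches correspond as well). [folklore] -/
theorem boundedMatrixWilsonFlow_translate {R : Type*} [AddCommGroup R] [One R]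
    (H : Set (Matrix (Fin N) (Fin N) ℂ)) (t : ℝ) (V : MatrixLinkField d R N) (a : Fin d → R) :
    boundedMatrixWilsonFlow H t (V ∘ Prod.map (· + a) id) =
      boundedMatrixWilsonFlow H t V ∘ Prod.map (· + a) id := by
  have hinv : ∀ W : MatrixLinkField d R N,
      (W ∘ Prod.map (· + a) id) ∘ Prod.map (· + -a) id = W := fun W => by
    funext ⟨x, μ⟩; simp
  by_cases h : ∃ Φ, IsBoundedWilsonFlowLine H V Φ
  · have hb : IsBoundedWilsonFlowLine H (V ∘ Prod.map (· + a) id)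
        fun t => boundedMatrixWilsonFlow H t V ∘ Prod.map (· + a) id :=
      (isBoundedWilsonFlowLine_boundedMatrixWilsonFlow h).comp (isShiftCompatible_add_const a)
    exact (hb.eq_boundedMatrixWilsonFlow t).symm
  · have h' : ¬ ∃ Ψ, IsBoundedWilsonFlowLine H (V ∘ Prod.map (· + a) id) Ψ := by
      rintro ⟨Ψ, hΨ⟩
      refine h ⟨fun t => Ψ t ∘ Prod.map (· + -a) id, ?_⟩
      have := hΨ.comp (isShiftCompatible_add_const (-a))
      rwa [hinv] at this
    rw [boundedMatrixWilsonFlow_of_not_exists h, boundedMatrixWilsonFlow_of_not_exists h']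

end Comp

/-! ### The periodic lift of the torus flow -/

section Lift

open Literature.Probability.LatticeModels (Torus.proj)

variable {d : ℕ} {N : ℕ} {S : ℕ}

/-- `torusEdge S` is the action on links of the reduction `Torus.proj S`. [folklore] -/
theorem torusEdge_eq_prodMap (S : ℕ) :
    (torusEdge (d := d) S) = Prod.map (Torus.proj S) id := rfl

/-- The flow vector field commutes with the periodic lift: `Z(W ∘ π) = Z(W) ∘ π` for the
reduction of links `π = torusEdge S`. [folklore] -/
theorem wilsonFlowField_comp_torusEdge (H : Set (Matrix (Fin N) (Fin N) ℂ))
    (W : MatrixLinkField d (ZMod S) N) :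
    wilsonFlowField H (W ∘ torusEdge S) = wilsonFlowField H W ∘ torusEdge S :=
  wilsonFlowField_comp H (isShiftCompatible_torusProj S) W

/-- `Torus.proj S` is additive. [folklore] -/
private theorem torusProj_add_aux (S : ℕ) (x y : Fin d → ℤ) :
    Torus.proj S (x + y) = Torus.proj S x + Torus.proj S y := by
  funext i; simp

/-- `Torus.proj S` is surjective (for `S ≠ 0`; a section is `y ↦ (y i).val`). [folklore] -/
private theorem torusProj_surjective_aux (S : ℕ) [NeZero S] :
    Function.Surjective (Torus.proj (d := d) S) := fun y =>
  ⟨fun i => ((y i).val : ℤ), by funext i; simp⟩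

/-- **Periodicity**: a bounded flow line on `ℤ^d` with `S`-periodic initial data is `S`-periodic
at all times (its translate by a period is a bounded flow line from the same data; uniqueness). [folklore] -/
theorem IsBoundedWilsonFlowLine.periodic {H : Set (Matrix (Fin N) (Fin N) ℂ)}
    {V : MatrixLinkField d (ZMod S) N} {Ψ : ℝ → MatrixLinkField d ℤ N}
    (hΨ : IsBoundedWilsonFlowLine H (V ∘ torusEdge S) Ψ) {a : Fin d → ℤ}
    (ha : Torus.proj S a = 0) (t : ℝ) (e : (Fin d → ℤ) × Fin d) :
    Ψ t (e.1 + a, e.2) = Ψ t e := by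
  have hper : (V ∘ torusEdge S) ∘ Prod.map (· + a) id = V ∘ torusEdge S := by
    funext ⟨x, μ⟩
    simp only [Function.comp_apply, Prod.map_apply, id_eq, torusEdge, torusProj_add_aux, ha,
      add_zero]
  have h1 : IsBoundedWilsonFlowLine H (V ∘ torusEdge S) fun t => Ψ t ∘ Prod.map (· + a) id := by
    have := hΨ.comp (isShiftCompatible_add_const a)
    rwa [hper] at this
  exact congr_fun (congr_fun (h1.unique hΨ) t) e

/-- **Existence of a bounded flow line on `ℤ^d` from periodic data is equivalent to existence of
a torus flow line**: `←` is the periodic lift (bounded: finitely many continuous entries); `→`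
descends a bounded flow line, periodic by `IsBoundedWilsonFlowLine.periodic`, along any section
of `Torus.proj S`. [folklore] -/
theorem exists_isBoundedWilsonFlowLine_comp_torusEdge_iff [NeZero S]
    (H : Set (Matrix (Fin N) (Fin N) ℂ)) (V : MatrixLinkField d (ZMod S) N) :
    (∃ Ψ, IsBoundedWilsonFlowLine H (V ∘ torusEdge S) Ψ) ↔ ∃ Φ, IsWilsonFlowLine H V Φ := by
  constructor
  · rintro ⟨Ψ, hΨ⟩
    set σ := Function.surjInv (torusProj_surjective_aux (d := d) S)
    have hσ : ∀ y, Torus.proj S (σ y) = y :=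
      Function.surjInv_eq (torusProj_surjective_aux (d := d) S)
    -- `Ψ` is the lift of its restriction along the section `σ`
    have hlift : ∀ t,
        Ψ t = (fun e' : (Fin d → ZMod S) × Fin d => Ψ t (σ e'.1, e'.2)) ∘ torusEdge S := by
      intro t
      funext e
      have hker : Torus.proj S (σ (Torus.proj S e.1) - e.1) = 0 := by
        rw [show σ (Torus.proj S e.1) - e.1 = σ (Torus.proj S e.1) + -e.1 from sub_eq_add_neg _ _,
          torusProj_add_aux, hσ]
        have : Torus.proj S (-e.1) = -Torus.proj S e.1 := by funext i; simp
        rw [this, add_neg_cancel]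
      have := hΨ.periodic hker t e
      simp only [add_sub_cancel] at this
      simpa [torusEdge] using this.symm
    refine ⟨fun t e' => Ψ t (σ e'.1, e'.2), ?_, fun t e' i j => ?_⟩
    · funext e'
      have := congr_fun hΨ.1.1 (σ e'.1, e'.2)
      simpa [torusEdge, hσ] using this
    · have hd := hΨ.1.2 t (σ e'.1, e'.2) i j
      rw [hlift t, wilsonFlowField_comp_torusEdge] at hd
      simpa [torusEdge, hσ] using hd
  · rintro ⟨Φ, hΦ⟩
    exact ⟨fun t => Φ t ∘ torusEdge S, hΦ.isBounded.comp (isShiftCompatible_torusProj S)⟩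

/-- **The bounded flow of periodic data is the periodic lift of the torus flow** (matrix level,
unconditionally: when the torus flow line exists both sides are the unique bounded flow line from
the lifted data, otherwise both are the lifted constant field):
`boundedMatrixWilsonFlow H t (V ∘ torusEdge S) = matrixWilsonFlow H t V ∘ torusEdge S`. [cite: Luscher2010, eq. (1.4)] -/
theorem boundedMatrixWilsonFlow_comp_torusEdge [NeZero S] (H : Set (Matrix (Fin N) (Fin N) ℂ))
    (t : ℝ) (V : MatrixLinkField d (ZMod S) N) :
    boundedMatrixWilsonFlow H t (V ∘ torusEdge S) = matrixWilsonFlow H t V ∘ torusEdge S := by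
  by_cases h : ∃ Φ, IsWilsonFlowLine H V Φ
  · have hb : IsBoundedWilsonFlowLine H (V ∘ torusEdge S)
        fun t => (fun t => matrixWilsonFlow H t V) t ∘ torusEdge S :=
      (isWilsonFlowLine_matrixWilsonFlow h).isBounded.comp (isShiftCompatible_torusProj S)
    exact (hb.eq_boundedMatrixWilsonFlow t).symm
  · have hb : ¬ ∃ Ψ, IsBoundedWilsonFlowLine H (V ∘ torusEdge S) Ψ :=
      fun hb => h ((exists_isBoundedWilsonFlowLine_comp_torusEdge_iff H V).1 hb)
    rw [boundedMatrixWilsonFlow_of_not_exists hb, matrixWilsonFlow, dif_neg h]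

end Lift

/-! ### Static densities of a link field -/

section Densities

variable {d : ℕ} {R R' : Type*} [AddGroup R] [One R] [AddGroup R'] [One R'] {N : ℕ}

/-- The plaquette matrix `W(x,μ) W(x+μ̂,ν) W(x+ν̂,μ)† W(x,ν)†` of a link field `W` at `x` in the
`(μ, ν)`-plane (junk for `μ = ν`); `flowedPlaquette ρ t U = plaquetteMatrix (wilsonFlowMatrix ρ t U)`
(`flowedPlaquette_eq_plaquetteMatrix`). [cite: Luscher2010, eq. (3.1)] -/
def plaquetteMatrix (W : MatrixLinkField d R N) (x : Fin d → R) (μ ν : Fin d) :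
    Matrix (Fin N) (Fin N) ℂ :=
  W (x, μ) * W (x + Pi.single μ 1, ν) * (W (x + Pi.single ν 1, μ))ᴴ * (W (x, ν))ᴴ

/-- **The action density of a link field** (plaquette definition, lattice units):
`E(x) = 2 ∑_{p ∈ P_x} Re tr{1 − W(p)} = 2 ∑_{μ<ν} (N − Re tr W(p_{x,μν}))`;
`flowedEnergy ρ t x U = energyDensity (wilsonFlowMatrix ρ t U) x` (`flowedEnergy_eq_energyDensity`). [cite: Luscher2010, eq. (3.1)] -/
def energyDensity (W : MatrixLinkField d R N) (x : Fin d → R) : ℝ :=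
  2 * ∑ μ : Fin d, ∑ ν : Fin d,
    if μ < ν then ((N : ℝ) - (plaquetteMatrix W x μ ν).trace.re) else 0

/-- The plaquette matrix commutes with shift-compatible changes of site type. [folklore] -/
theorem plaquetteMatrix_comp {f : (Fin d → R) → (Fin d → R')} (hf : IsShiftCompatible f)
    (W : MatrixLinkField d R' N) (x : Fin d → R) (μ ν : Fin d) :
    plaquetteMatrix (W ∘ Prod.map f id) x μ ν = plaquetteMatrix W (f x) μ ν := by
  have h1 : ∀ x μ, f (x + Pi.single μ 1) = f x + Pi.single μ 1 := fun x μ => (hf x μ).1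
  simp only [plaquetteMatrix, Function.comp_apply, Prod.map_apply, id_eq, h1]

/-- The action density commutes with shift-compatible changes of site type:
`E(W ∘ f)(x) = E(W)(f x)`. [folklore] -/
theorem energyDensity_comp {f : (Fin d → R) → (Fin d → R')} (hf : IsShiftCompatible f)
    (W : MatrixLinkField d R' N) (x : Fin d → R) :
    energyDensity (W ∘ Prod.map f id) x = energyDensity W (f x) := by
  simp only [energyDensity, plaquetteMatrix_comp hf]

end Densities

/-! ### Gauge-group level: the bounded flow of `ρ(U)` and its flowed action density -/

section GroupLevel

variable {d : ℕ} {R : Type*} [AddGroup R] [One R] {N : ℕ} {G : Type*} [Group G]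
variable (ρ : G →* Matrix (Fin N) (Fin N) ℂ)

/-- **The bounded-flow link matrices** `V_t = (ρ(U))_t`: the bounded Wilson flow (1.4) of the
`ρ`-image of the configuration `U` (cf. the tree's `wilsonFlowMatrix`, which it equals on every
finite lattice, `boundedWilsonFlowMatrix_eq_wilsonFlowMatrix`); on `ℤ^d` (`U : LGConfig d G`) and
periodic `U` it is the periodic extension of the torus flow (`boundedWilsonFlowMatrix_torusLift`). [cite: Luscher2010, eq. (1.4)] -/
def boundedWilsonFlowMatrix (t : ℝ) (U : (Fin d → R) × Fin d → G) : MatrixLinkField d R N :=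
  boundedMatrixWilsonFlow (Set.range ρ) t fun e => ρ (U e)

/-- At flow time `0` the bounded-flow link matrices are `ρ(U)`. [cite: Luscher2010, eq. (1.4)] -/
@[simp]
theorem boundedWilsonFlowMatrix_zero (U : (Fin d → R) × Fin d → G) :
    boundedWilsonFlowMatrix ρ 0 U = fun e => ρ (U e) :=
  boundedMatrixWilsonFlow_zero _ _

/-- On a finite lattice (e.g. the torus) the bounded-flow link matrices are the tree's
`wilsonFlowMatrix`. [folklore] -/
theorem boundedWilsonFlowMatrix_eq_wilsonFlowMatrix [Finite R] (t : ℝ)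
    (U : (Fin d → R) × Fin d → G) : boundedWilsonFlowMatrix ρ t U = wilsonFlowMatrix ρ t U :=
  boundedMatrixWilsonFlow_eq_matrixWilsonFlow _ _ _

/-- The tree's flowed plaquette is the plaquette matrix of the flowed link field. [folklore] -/
theorem flowedPlaquette_eq_plaquetteMatrix (t : ℝ) (U : (Fin d → R) × Fin d → G) (x : Fin d → R)
    (μ ν : Fin d) : flowedPlaquette ρ t U x μ ν = plaquetteMatrix (wilsonFlowMatrix ρ t U) x μ ν :=
  rfl

/-- The tree's flowed action density is the action density of the flowed link field. [folklore] -/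
theorem flowedEnergy_eq_energyDensity (t : ℝ) (x : Fin d → R) (U : (Fin d → R) × Fin d → G) :
    flowedEnergy ρ t x U = energyDensity (wilsonFlowMatrix ρ t U) x :=
  rfl

/-- **The flowed action density along the bounded flow** `E_t(x)` (plaquette definition (3.1),
lattice units): `energyDensity (boundedWilsonFlowMatrix ρ t U) x`. On a finite lattice it is the
tree's `flowedEnergy` (`boundedFlowedEnergy_eq_flowedEnergy`); on `ℤ^d`, read on periodic lifts
as every observable of `YangMillsOS`/`FlowScale`, it is the torus density
(`boundedFlowedEnergy_torusLift`) — the intended instance `E t Ũ = boundedFlowedEnergy ρ t 0 Ũ` of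
`flowScale` / `FlowSchemeData`. [cite: Luscher2010, eq. (3.1)] -/
def boundedFlowedEnergy (t : ℝ) (x : Fin d → R) (U : (Fin d → R) × Fin d → G) : ℝ :=
  energyDensity (boundedWilsonFlowMatrix ρ t U) x

/-- `boundedFlowedEnergy` unfolded. [folklore] -/
theorem boundedFlowedEnergy_eq (t : ℝ) (x : Fin d → R) (U : (Fin d → R) × Fin d → G) :
    boundedFlowedEnergy ρ t x U = energyDensity (boundedWilsonFlowMatrix ρ t U) x :=
  rfl

/-- On a finite lattice the bounded flowed density is the tree's `flowedEnergy`. [folklore] -/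
theorem boundedFlowedEnergy_eq_flowedEnergy [Finite R] (t : ℝ) (x : Fin d → R)
    (U : (Fin d → R) × Fin d → G) : boundedFlowedEnergy ρ t x U = flowedEnergy ρ t x U := by
  rw [boundedFlowedEnergy, boundedWilsonFlowMatrix_eq_wilsonFlowMatrix,
    flowedEnergy_eq_energyDensity]

/-- At flow time `0` both densities are the plaquette density of `ρ(U)`. [folklore] -/
theorem boundedFlowedEnergy_zero (x : Fin d → R) (U : (Fin d → R) × Fin d → G) :
    boundedFlowedEnergy ρ 0 x U = flowedEnergy ρ 0 x U := by
  rw [boundedFlowedEnergy, boundedWilsonFlowMatrix_zero, flowedEnergy_eq_energyDensity,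
    wilsonFlowMatrix_zero]

/-- For unitary `ρ` the plaquette matrix of `ρ(W)` is `ρ` of the tree's plaquette holonomy
(torus). [folklore] -/
theorem plaquetteMatrix_map_of_mem_unitaryGroup {L : ℕ}
    (hρ : ∀ g, ρ g ∈ Matrix.unitaryGroup (Fin N) ℂ)
    (W : Literature.MathematicalPhysics.QuantumFieldTheory.GaugeConfig d L G)
    (x : Literature.MathematicalPhysics.QuantumFieldTheory.Site d L) (μ ν : Fin d) :
    plaquetteMatrix (fun e => ρ (W e)) x μ ν =
      ρ (Literature.MathematicalPhysics.QuantumFieldTheory.plaquetteHolonomy W x μ ν) := by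
  simp only [plaquetteMatrix, conjTranspose_map_of_mem_unitaryGroup ρ hρ, ← map_mul,
    Literature.MathematicalPhysics.QuantumFieldTheory.plaquetteHolonomy,
    Literature.MathematicalPhysics.QuantumFieldTheory.Site.shift]

/-- For unitary `ρ` the action density of `ρ(W)` is the route's inline plaquette expression
`2 ∑_{μ<ν} (N − Re tr ρ(W_{p_{x,μν}}))` (torus). [cite: Luscher2010, eq. (3.1)] -/
theorem energyDensity_map_of_mem_unitaryGroup {L : ℕ}
    (hρ : ∀ g, ρ g ∈ Matrix.unitaryGroup (Fin N) ℂ)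
    (W : Literature.MathematicalPhysics.QuantumFieldTheory.GaugeConfig d L G)
    (x : Literature.MathematicalPhysics.QuantumFieldTheory.Site d L) :
    energyDensity (fun e => ρ (W e)) x = 2 * ∑ μ : Fin d, ∑ ν : Fin d,
      if μ < ν then ((N : ℝ) -
        (ρ (Literature.MathematicalPhysics.QuantumFieldTheory.plaquetteHolonomy W x μ ν)).trace.re)
      else 0 := by
  simp only [energyDensity, plaquetteMatrix_map_of_mem_unitaryGroup ρ hρ]

/-- **Torus flow lines compute the flowed density**: if `B` is a (`G`-valued) flow line of the
torus configuration `U` in the sense of the route items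
(`IsWilsonFlowLine (range ρ) (ρ ∘ U) (ρ ∘ B)`), then `flowedEnergy ρ t x U` is the plaquette
density of `B t` — uniqueness of flow lines on the finite torus. [folklore] -/
theorem flowedEnergy_eq_of_isWilsonFlowLine {L : ℕ} [NeZero L]
    (hρ : ∀ g, ρ g ∈ Matrix.unitaryGroup (Fin N) ℂ)
    {U : Literature.MathematicalPhysics.QuantumFieldTheory.GaugeConfig d L G}
    {B : ℝ → Literature.MathematicalPhysics.QuantumFieldTheory.GaugeConfig d L G}
    (hB : IsWilsonFlowLine (Set.range ρ) (fun e => ρ (U e)) fun s e => ρ (B s e)) (t : ℝ)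
    (x : Literature.MathematicalPhysics.QuantumFieldTheory.Site d L) :
    flowedEnergy ρ t x U = 2 * ∑ μ : Fin d, ∑ ν : Fin d,
      if μ < ν then ((N : ℝ) -
        (ρ (Literature.MathematicalPhysics.QuantumFieldTheory.plaquetteHolonomy (B t) x μ ν)).trace.re)
      else 0 := by
  rw [flowedEnergy_eq_energyDensity, wilsonFlowMatrix, ← hB.eq_matrixWilsonFlow t]
  exact energyDensity_map_of_mem_unitaryGroup ρ hρ (B t) x

end GroupLevel

/-! ### The periodic lift at the gauge-group level -/

section TorusLiftGroup

open Literature.Probability.LatticeModels (Torus.proj)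
open Literature.MathematicalPhysics.QuantumFieldTheory (GaugeConfig)

variable {d N : ℕ} {G : Type*} [Group G] (ρ : G →* Matrix (Fin N) (Fin N) ℂ) {S : ℕ}

/-- **The periodic lift of the torus Wilson flow** (the notion `boundedWilsonFlowLift`): the
`S`-periodic link field on `ℤ^d` whose value on the link `(x, μ)` is the flowed torus link matrix
`V_t(U)(x mod S, μ)` — Lüscher's flow of a periodic lattice gauge field read on the infinite
lattice. It IS the bounded Wilson flow of the lifted configuration `torusLift S U`
(`boundedWilsonFlowMatrix_torusLift`) and, when the torus flow line exists, the unique bounded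
flow line from `ρ(torusLift S U)` (`isBoundedWilsonFlowLine_boundedWilsonFlowLift`). [cite: Luscher2010, eq. (1.4)] -/
def boundedWilsonFlowLift (S : ℕ) (t : ℝ) (U : GaugeConfig d S G) : MatrixLinkField d ℤ N :=
  wilsonFlowMatrix ρ t U ∘ torusEdge S

/-- `boundedWilsonFlowLift` evaluated: `(x, μ) ↦ V_t(U)(x mod S, μ)`. [folklore] -/
theorem boundedWilsonFlowLift_apply (S : ℕ) (t : ℝ) (U : GaugeConfig d S G)
    (e : (Fin d → ℤ) × Fin d) :
    boundedWilsonFlowLift ρ S t U e = wilsonFlowMatrix ρ t U (torusEdge S e) :=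
  rfl

/-- At flow time `0` the lift of the flow is `ρ` of the lifted configuration. [folklore] -/
@[simp]
theorem boundedWilsonFlowLift_zero (S : ℕ) (U : GaugeConfig d S G) :
    boundedWilsonFlowLift ρ S 0 U = fun e => ρ (torusLift S U e) := by
  funext e
  rw [boundedWilsonFlowLift_apply, wilsonFlowMatrix_zero]
  rfl

/-- **The bounded Wilson flow of a periodic configuration is the periodic lift of the torus
Wilson flow**: `boundedWilsonFlowMatrix ρ t (torusLift S U) = boundedWilsonFlowLift ρ S t U`,
unconditionally (the junk branches correspond). [cite: Luscher2010, eq. (1.4)] -/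
theorem boundedWilsonFlowMatrix_torusLift [NeZero S] (t : ℝ) (U : GaugeConfig d S G) :
    boundedWilsonFlowMatrix ρ t (torusLift S U) = boundedWilsonFlowLift ρ S t U :=
  boundedMatrixWilsonFlow_comp_torusEdge (Set.range ρ) t fun e => ρ (U e)

/-- When the torus flow line of `ρ(U)` exists (always, for unitary `ρ` — Lüscher p. 2), the lift
`t ↦ boundedWilsonFlowLift ρ S t U` is a bounded flow line on `ℤ^d` from `ρ(torusLift S U)`, hence
the unique one. [cite: Luscher2010, §1 p. 2] -/
theorem isBoundedWilsonFlowLine_boundedWilsonFlowLift [NeZero S] {U : GaugeConfig d S G}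
    (h : ∃ Φ, IsWilsonFlowLine (Set.range ρ) (fun e => ρ (U e)) Φ) :
    IsBoundedWilsonFlowLine (Set.range ρ) (fun e => ρ (torusLift S U e))
      fun t => boundedWilsonFlowLift ρ S t U :=
  (isWilsonFlowLine_matrixWilsonFlow h).isBounded.comp (isShiftCompatible_torusProj S)

/-- The bounded flow of a periodic configuration in terms of ANY torus flow line `Φ` of `ρ(U)`:
`boundedWilsonFlowMatrix ρ t (torusLift S U) = Φ_t ∘ torusEdge S`. [folklore] -/
theorem IsWilsonFlowLine.boundedWilsonFlowMatrix_torusLift_eq [NeZero S] {U : GaugeConfig d S G}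
    {Φ : ℝ → MatrixLinkField d (ZMod S) N}
    (hΦ : IsWilsonFlowLine (Set.range ρ) (fun e => ρ (U e)) Φ) (t : ℝ) :
    boundedWilsonFlowMatrix ρ t (torusLift S U) = Φ t ∘ torusEdge S := by
  rw [_root_.Literature.MathematicalPhysics.QuantumLattice.boundedWilsonFlowMatrix_torusLift,
    boundedWilsonFlowLift, wilsonFlowMatrix, ← hΦ.eq_matrixWilsonFlow t]

/-- **The lift lemma for the flowed action density**:
`boundedFlowedEnergy ρ t x (torusLift S U) = flowedEnergy ρ t (x mod S) U` — the flowed density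
of the periodic lift, computed with the bounded flow on `ℤ^d`, is the torus flowed density at the
reduced site. [cite: Luscher2010, eqs. (1.4) and (3.1)] -/
theorem boundedFlowedEnergy_torusLift [NeZero S] (t : ℝ) (x : Fin d → ℤ) (U : GaugeConfig d S G) :
    boundedFlowedEnergy ρ t x (torusLift S U) = flowedEnergy ρ t (Torus.proj S x) U := by
  rw [boundedFlowedEnergy, boundedWilsonFlowMatrix_torusLift, boundedWilsonFlowLift,
    torusEdge_eq_prodMap, energyDensity_comp (isShiftCompatible_torusProj S),
    flowedEnergy_eq_energyDensity]

/-- `Torus.proj S 0 = 0`. [folklore] -/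
private theorem torusProj_zero_aux (S : ℕ) : Torus.proj S (0 : Fin d → ℤ) = 0 := by
  funext i; simp

/-- The lift lemma at the origin: `boundedFlowedEnergy ρ t 0 (torusLift S U) = flowedEnergy ρ t 0 U`. [folklore] -/
theorem boundedFlowedEnergy_torusLift_zero [NeZero S] (t : ℝ) (U : GaugeConfig d S G) :
    boundedFlowedEnergy ρ t 0 (torusLift S U) = flowedEnergy ρ t 0 U := by
  rw [boundedFlowedEnergy_torusLift, torusProj_zero_aux]

end TorusLiftGroup

/-! ### Lüscher's `t₀` of the torus, and the `t₀`-scheme re-based on it -/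

section Scale

open MeasureTheory
open Literature.MathematicalPhysics.QuantumFieldTheory Literature.Probability.LatticeModels

variable {N : ℕ} {G : Type*} [Group G] [TopologicalSpace G] [IsTopologicalGroup G]
  [CompactSpace G] [MeasurableSpace G] [BorelSpace G]

/-- **Lüscher's flow scale `t₀(β, S)` at the torus level** (lattice units): the reference flow
time `flowScaleOf` of the profile `τ ↦ ∫ E_τ(0) dμ_{S,β}` of the torus flowed action density
`flowedEnergy ρ τ 0` (torus Wilson flow, `R = ZMod S`, where flow lines are unique) under the
torus Wilson measure — `{t² ⟨E⟩}_{t = t₀} = 0.3`. Equal to the tree's `flowScale` of the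
bounded-flow density read on periodic lifts (`flowScale_boundedFlowedEnergy`). [cite: Luscher2010, §3.4 eq. (3.3)] -/
def flowScaleTorus (d : ℕ) (ρ : G →* Matrix (Fin N) (Fin N) ℂ) (β : ℝ) (S : ℕ) [NeZero S] : ℝ :=
  flowScaleOf fun τ =>
    ∫ U, flowedEnergy ρ τ (0 : Fin d → ZMod S) U ∂(wilsonMeasure (d := d) (L := S) ρ β)

/-- `flowScaleTorus` unfolded. [folklore] -/
theorem flowScaleTorus_eq (d : ℕ) (ρ : G →* Matrix (Fin N) (Fin N) ℂ) (β : ℝ) (S : ℕ) [NeZero S] :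
    flowScaleTorus d ρ β S = flowScaleOf fun τ =>
      ∫ U, flowedEnergy ρ τ (0 : Fin d → ZMod S) U ∂(wilsonMeasure (d := d) (L := S) ρ β) :=
  rfl

/-- `t₀(β, S) ≥ 0`. [folklore] -/
theorem flowScaleTorus_nonneg (d : ℕ) (ρ : G →* Matrix (Fin N) (Fin N) ℂ) (β : ℝ) (S : ℕ)
    [NeZero S] : 0 ≤ flowScaleTorus d ρ β S :=
  flowScaleOf_nonneg _

/-- **The expected profile of the bounded-flow density on periodic lifts is the torus profile**:
`flowProfile ρ (t, Ũ ↦ boundedFlowedEnergy ρ t 0 Ũ) β S = (τ ↦ ∫ flowedEnergy ρ τ 0 U dμ_{S,β})`. [folklore] -/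
theorem flowProfile_boundedFlowedEnergy {d : ℕ} (ρ : G →* Matrix (Fin N) (Fin N) ℂ) (β : ℝ) (S : ℕ)
    [NeZero S] :
    flowProfile ρ (fun t (Ũ : LGConfig d G) => boundedFlowedEnergy ρ t 0 Ũ) β S = fun τ =>
      ∫ U, flowedEnergy ρ τ (0 : Fin d → ZMod S) U ∂(wilsonMeasure (d := d) (L := S) ρ β) := by
  funext τ
  simp only [flowProfile, boundedFlowedEnergy_torusLift_zero]

/-- **`flowScale` of the bounded-flow density is the torus `t₀`**:
`flowScale ρ (t, Ũ ↦ boundedFlowedEnergy ρ t 0 Ũ) β S = flowScaleTorus d ρ β S` — the intended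
instance of the tree's `flowScale` is Lüscher's torus quantity. [cite: Luscher2010, §3.4 eq. (3.3)] -/
theorem flowScale_boundedFlowedEnergy {d : ℕ} (ρ : G →* Matrix (Fin N) (Fin N) ℂ) (β : ℝ) (S : ℕ)
    [NeZero S] :
    flowScale ρ (fun t (Ũ : LGConfig d G) => boundedFlowedEnergy ρ t 0 Ũ) β S =
      flowScaleTorus d ρ β S := by
  rw [flowScale, flowProfile_boundedFlowedEnergy, flowScaleTorus]

end Scale

section Obs

open Literature.MathematicalPhysics.QuantumFieldTheory

variable {G : Type} [Group G] [TopologicalSpace G]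

/-- **The flowed-density observable of the `t₀`-scheme**: `E t Ũ = boundedFlowedEnergy r.ρ t 0 Ũ`,
the flowed action density (3.1) at the origin along the bounded Wilson flow on `ℤ⁴` — the intended
`E` of `FlowSchemeData r E`. [cite: Luscher2010, eq. (3.1)] -/
def boundedFlowedEnergyObs (r : LatticeRep G) : ℝ → LGConfig 4 G → ℝ :=
  fun t Ũ => boundedFlowedEnergy r.ρ t 0 Ũ

/-- `boundedFlowedEnergyObs` unfolded. [folklore] -/
@[simp] theorem boundedFlowedEnergyObs_apply (r : LatticeRep G) (t : ℝ) (Ũ : LGConfig 4 G) :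
    boundedFlowedEnergyObs r t Ũ = boundedFlowedEnergy r.ρ t 0 Ũ := rfl

end Obs

section Scheme

open MeasureTheory
open Literature.MathematicalPhysics.QuantumFieldTheory Literature.Probability.LatticeModels

variable {G : Type} [Group G] [TopologicalSpace G] [IsTopologicalGroup G] [CompactSpace G]
  [MeasurableSpace G] [BorelSpace G]

/-- **The `t₀`-scheme re-based on the torus flow**: for the flowed-density observable, the
reference flow time of `FlowSchemeData` at step `k` is Lüscher's torus `t₀(β_k, 2L_k+1)`,
`D.t0 k = flowScaleTorus 4 r.ρ (β k) (2 L k + 1)`; in particular the three admissibility fields of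
`FlowSchemeData r (boundedFlowedEnergyObs r)` are statements about `flowScaleTorus`. [cite: Luscher2010, §3.5 (b)] -/
theorem FlowSchemeData.t0_eq_flowScaleTorus {r : LatticeRep G}
    (D : FlowSchemeData r (boundedFlowedEnergyObs r)) (k : ℕ) :
    D.t0 k = flowScaleTorus 4 r.ρ (D.β k) (2 * D.L k + 1) :=
  flowScale_boundedFlowedEnergy r.ρ (D.β k) (2 * D.L k + 1)

/-- The admissibility fields of the re-based scheme, read on the torus: `t₀ > 0`, `t₀ → ∞` and
`L_k/√t₀ → ∞` for `flowScaleTorus`. [cite: Luscher2010, §3.5 (b)] -/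
theorem FlowSchemeData.flowScaleTorus_spec {r : LatticeRep G}
    (D : FlowSchemeData r (boundedFlowedEnergyObs r)) :
    (∀ k, 0 < flowScaleTorus 4 r.ρ (D.β k) (2 * D.L k + 1)) ∧
      Tendsto (fun k => flowScaleTorus 4 r.ρ (D.β k) (2 * D.L k + 1)) atTop atTop ∧
      Tendsto (fun k => (D.L k : ℝ) / Real.sqrt (flowScaleTorus 4 r.ρ (D.β k) (2 * D.L k + 1)))
        atTop atTop := by
  refine ⟨fun k => ?_, ?_, ?_⟩
  · rw [← D.t0_eq_flowScaleTorus]; exact D.t0_pos k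
  · simpa only [FlowSchemeData.t0_eq_flowScaleTorus] using
      (show Tendsto (fun k => D.t0 k) atTop atTop from D.tendsto_flowScale)
  · simpa only [FlowSchemeData.t0_eq_flowScaleTorus] using
      (show Tendsto (fun k => (D.L k : ℝ) / Real.sqrt (D.t0 k)) atTop atTop from D.tendsto_div_sqrt)

end Scheme




end Literature.MathematicalPhysics.QuantumLattice

end
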